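import Summits.HodgeConjecture.HodgeConjecture.Theorems.NikulinTwinTransportRealMultiplicationPointwise
import Summits.HodgeConjecture.HodgeConjecture.Theorems.NikulinTwinTransportRealMultiplicationAnchorOfAlgebraic
import Summits.HodgeConjecture.HodgeConjecture.Theorems.NikulinTwinTransportTwinTransportRMPicardTwoSelfAdjoint

/-!
# Route NikulinTwinTransport · crux `TwinTransportRMPicardTwo` (stmt-HodgeConjecture-15067) —
# its place between the transport crux and real multiplication at Picard rank two

The judge's milestone `TwinTransportRMPicardTwo` asks, for every projective K3 surface `S` of
Picard rank `2` carrying real multiplication by `√2` on `T(S)` (a rational, type-preserving `e`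
killing `NS := algebraicClasses S 1` with `e² = 2` on `NS^⊥`), for an ALGEBRAIC anchor: a
projective K3 partner `S″`, an integral generator `p″` of `H⁴` and an algebraic `ℂ`-linear
equivalence `Ψ : H²(S″) ≃ H²(S)` whose inverse is rational, type-preserving and halves the cup
form. Standalone it is an open sub-case of the Hodge conjecture (van Geemen–Schütt 2023, Rem. 4.9:
no inducing cycle is known on the maximal RM-`√2` families). This file records, kernel-checked,
where it sits in the route:

* `twinTransportRMPicardTwo_of_twinTwistorTransport` — it is the literal special case of the
  transport crux `TwinTwistorTransport` (stmt-HodgeConjecture-14393): drop the Picard-rank clause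
  and the endomorphism `e`.
* `realMultiplication_algebraic_rankTwo_of_twinTransportRMPicardTwo` — the milestone DELIVERS real
  multiplication at Picard rank two: granted Buskin's theorem (`HodgeIsometryAlgebraic`), the
  composition of algebraic correspondences between surfaces and the three named K3 facts
  (`Huybrechts_K3_marking_exists`, `Huybrechts_K3_hodgeTypes_H2`,
  `Grothendieck1969_supportedClasses_le_hodgeConiveau`), every rational, type-preserving,
  cup-self-adjoint `e` killing `NS` with `e² = 2` on `NS^⊥` on a projective K3 surface of Picard
  rank `2` is `[γ]_*` for an algebraic `γ` on `S × S` — the body of the route's deliverable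
  `RealMultiplicationSqrtTwoAlgebraic` (stmt-HodgeConjecture-13679) restricted to `finrank NS = 2`
  (the sector of the maximal `8`-dimensional RM-`√2` families, `rank T = 20`). Proof: the
  milestone's anchor at `(S, e)` is exactly hypothesis `hA` of the landed pointwise reduction
  `realMultiplication_algebraic_at_of_anchors_at` (`e + ν̃` is a rational Hodge `2`-similitude of
  `H²(S)`, `Ψ⁻¹ ∘ (e + ν̃)` a rational Hodge isometry, algebraic by Buskin, and `ν̃` is a sum of
  divisor correspondences).

* `twinTransportRMPicardTwo_of_realMultiplicationSqrtTwoAlgebraic` — conversely, the milestone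
  BY NAME from the deliverable: `RealMultiplicationSqrtTwoAlgebraic` (all Picard ranks), the
  support item `LefschetzOneOneK3` (stmt-HodgeConjecture-13678) and the three named facts give
  `TwinTransportRMPicardTwo`. The milestone's `e` is not assumed cup-self-adjoint; it IS, by the
  sibling file's `realMultiplication_selfAdjoint` (Zarhin on the real carriers, the one place
  Lefschetz `(1,1)` enters), and then `S″ := S`, `Ψ := e + ν̃` is the anchor
  (`rmAnchors_of_realMultiplicationSqrtTwoAlgebraic`, seat prover-pitem-stmt-HodgeConjecture-13679-1).

So, modulo Buskin + composition of correspondences + Lefschetz `(1,1)` + the three facts, the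
judge's milestone is EXACTLY "real multiplication by `√2` is algebraic on every projective K3
surface of Picard rank `2` carrying it" — the open sub-case of the Hodge conjecture of
van Geemen–Schütt 2023, Rem. 4.9, no more and no less. Not here: the milestone itself (open),
Buskin's theorem, the composition of correspondences (moving lemma), Lefschetz `(1,1)`.
Prover seat prover-HodgeConjecture-route-HodgeConjecture-NikulinTwinTransport-1.

## References

* [VanGeemenSchuett2023] B. van Geemen, M. Schütt, arXiv:2310.05196, Thm. 3.10, Rem. 4.9.
* [Varesco2023] M. Varesco, Math. Z. 305 (2023), §2, Thm. 2.1, Rem. 2.2.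
* [Buskin2019] N. Buskin, J. reine angew. Math. 755 (2019), Thm. 1.1, Lemma 6.3.
-/

noncomputable section

namespace Summit.HodgeConjecture.HodgeConjecture.Theorems.NikulinTwinTransport

open scoped Manifold
open CategoryTheory MonoidalCategory SemiCartesianMonoidalCategory
open Literature.AlgebraicGeometry.Motives Literature.AlgebraicGeometry.HodgeTheory
open Literature.AlgebraicGeometry.Surfaces Literature.Geometry.Kaehler
open Literature.AlgebraicTopology.SingularHomology

/-- **The milestone is the literal special case of the transport crux**: `TwinTwistorTransport`
(an algebraic anchor into EVERY projective K3 surface) gives `TwinTransportRMPicardTwo` by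
forgetting the Picard-rank clause and the real multiplication `e`. [folklore] -/
theorem twinTransportRMPicardTwo_of_twinTwistorTransport
    (h : Theses.NikulinTwinTransport.TwinTwistorTransport) :
    Theses.NikulinTwinTransport.TwinTransportRMPicardTwo :=
  fun μ hμ S hS p hp _ _ _ _ _ _ => h μ hμ S hS p hp

/-- **The milestone delivers real multiplication at Picard rank two.** Granted Buskin's theorem
(`HodgeIsometryAlgebraic`), the composition `hC` of algebraic degree-`2` correspondences between
smooth projective surfaces, and the named facts `Huybrechts_K3_marking_exists`,
`Huybrechts_K3_hodgeTypes_H2`, `Grothendieck1969_supportedClasses_le_hodgeConiveau`, the crux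
`TwinTransportRMPicardTwo` implies: on every projective K3 surface `S` with
`finrank_ℂ (algebraicClasses S 1) = 2`, every rational, type-preserving, cup-self-adjoint `e`
killing `NS` with `e² = 2` on `NS^⊥` is `[γ]_*` for some `γ ∈ algebraicClasses (S ⊗ S) 2` — the
body of `RealMultiplicationSqrtTwoAlgebraic` restricted to Picard rank `2`. Proof: the milestone's
anchor at `(S, e)` is hypothesis `hA` of `realMultiplication_algebraic_at_of_anchors_at`.
[cite: Varesco2023, §2, Thm. 2.1 and Rem. 2.2] [cite: Buskin2019, Thm. 1.1 and Lemma 6.3]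
[cite: VanGeemenSchuett2023, Thm. 3.10 and Rem. 4.9] -/
theorem realMultiplication_algebraic_rankTwo_of_twinTransportRMPicardTwo
    (hB : Theses.NikulinTwinTransport.HodgeIsometryAlgebraic)
    (hC : ∀ (μ : OrientationFamily), μ.HasPoincareDuality →
      ∀ (A B C : SchemeOver ℂ) (hA : IsSmoothProjective 2 A) (hB : IsSmoothProjective 2 B)
        (hC : IsSmoothProjective 2 C),
        ∀ γ ∈ algebraicClasses (A ⊗ B) 2, ∀ γ₁ ∈ algebraicClasses (B ⊗ C) 2,
          ∃ γ₂ ∈ algebraicClasses (A ⊗ C) 2, ∀ x : complexBetti C (2 * 1),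
            complexGysin μ (IsSmoothProjective.tensor_holds hA hC) hA (fst A C)
                (rfl : 2 * 1 + 2 * 2 + 2 * 2 = 2 * 1 + 2 * (2 + 2))
                (cupProduct (rfl : 2 * 1 + 2 * 2 = 2 * 1 + 2 * 2)
                  (complexBetti.map (snd A C) (2 * 1) x) γ₂) =
              complexGysin μ (IsSmoothProjective.tensor_holds hA hB) hA (fst A B)
                (rfl : 2 * 1 + 2 * 2 + 2 * 2 = 2 * 1 + 2 * (2 + 2))
                (cupProduct (rfl : 2 * 1 + 2 * 2 = 2 * 1 + 2 * 2)
                  (complexBetti.map (snd A B) (2 * 1)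
                    (complexGysin μ (IsSmoothProjective.tensor_holds hB hC) hB (fst B C)
                      (rfl : 2 * 1 + 2 * 2 + 2 * 2 = 2 * 1 + 2 * (2 + 2))
                      (cupProduct (rfl : 2 * 1 + 2 * 2 = 2 * 1 + 2 * 2)
                        (complexBetti.map (snd B C) (2 * 1) x) γ₁)))
                  γ))
    (hmark : Huybrechts_K3_marking_exists) (hHT : Huybrechts_K3_hodgeTypes_H2)
    (hG : Grothendieck1969_supportedClasses_le_hodgeConiveau)
    (h : Theses.NikulinTwinTransport.TwinTransportRMPicardTwo)
    (μ : OrientationFamily) (hμ : μ.HasPoincareDuality) {S : SchemeOver ℂ} (hS : IsK3Surface S)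
    (hrank : Module.finrank ℂ ↥(algebraicClasses S 1) = 2)
    (e : complexBetti S (2 * 1) →ₗ[ℂ] complexBetti S (2 * 1))
    (he_rat : ∀ x, IsRationalClass x → IsRationalClass (e x))
    (he_type : ∀ (i j : ℕ) x, IsOfHodgeType 2 S (2 * 1) i j x → IsOfHodgeType 2 S (2 * 1) i j (e x))
    (he_adj : ∀ x y : complexBetti S (2 * 1),
      cupProduct (rfl : 2 * 1 + 2 * 1 = 2 * 2) (e x) y =
        cupProduct (rfl : 2 * 1 + 2 * 1 = 2 * 2) x (e y))
    (he_N : ∀ d ∈ algebraicClasses S 1, e d = 0)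
    (he_T : ∀ x : complexBetti S (2 * 1),
      (∀ d ∈ algebraicClasses S 1, cupProduct (rfl : 2 * 1 + 2 * 1 = 2 * 2) x d = 0) →
        e (e x) = (2 : ℂ) • x) :
    ∃ γ ∈ algebraicClasses (S ⊗ S) 2, ∀ x : complexBetti S (2 * 1),
      e x = complexGysin μ (IsSmoothProjective.tensor_holds hS.1 hS.1) hS.1 (fst S S)
        (rfl : 2 * 1 + 2 * 2 + 2 * 2 = 2 * 1 + 2 * (2 + 2))
        (cupProduct (rfl : 2 * 1 + 2 * 2 = 2 * 1 + 2 * 2)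
          (complexBetti.map (snd S S) (2 * 1) x) γ) :=
  realMultiplication_algebraic_at_of_anchors_at hB hC hmark hHT hG μ hμ hS
    (fun p hp => h μ hμ S hS p hp hrank e he_rat he_type he_N he_T) e he_rat he_type he_adj he_N he_T

/-- **The milestone by name from the deliverable.** `RealMultiplicationSqrtTwoAlgebraic` (real
multiplication by `√2` is algebraic on every projective K3 surface carrying it, stated for
cup-self-adjoint `e`), the support item `LefschetzOneOneK3` and the named facts
`Huybrechts_K3_marking_exists`, `Huybrechts_K3_hodgeTypes_H2`,
`Grothendieck1969_supportedClasses_le_hodgeConiveau` imply the crux `TwinTransportRMPicardTwo`: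
the milestone's `e` is cup-self-adjoint by `realMultiplication_selfAdjoint` (Zarhin), hence
algebraic by the deliverable, and then `S″ := S`, `p″ := p`, `Ψ := e + ν̃` (the Witt-corrected
rational Hodge `2`-similitude of `H²(S)`) is an algebraic anchor
(`rmAnchors_of_realMultiplicationSqrtTwoAlgebraic`). The Picard-rank clause is not used.
[cite: Zarhin1983, Thm. 1.5.1] [cite: Varesco2023, §2 and Rem. 2.2]
[cite: VanGeemenSchuett2023, Thm. 3.10 and Rem. 4.9] -/
theorem twinTransportRMPicardTwo_of_realMultiplicationSqrtTwoAlgebraic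
    (hmark : Huybrechts_K3_marking_exists) (hHT : Huybrechts_K3_hodgeTypes_H2)
    (hG : Grothendieck1969_supportedClasses_le_hodgeConiveau)
    (hL : Theses.NikulinTwinTransport.LefschetzOneOneK3)
    (h : Theses.NikulinTwinTransport.RealMultiplicationSqrtTwoAlgebraic) :
    Theses.NikulinTwinTransport.TwinTransportRMPicardTwo :=
  fun μ hμ _S hS p hp _ e he_rat he_type he_N he_T =>
    rmAnchors_of_realMultiplicationSqrtTwoAlgebraic h hmark hHT hG μ hμ hS p hp e he_rat he_type
      (realMultiplication_selfAdjoint hmark hHT hG hL hS e he_rat he_type he_N he_T) he_N he_T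

end Summit.HodgeConjecture.HodgeConjecture.Theorems.NikulinTwinTransport

end
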